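import Literature.Analysis.FluidPDE.ConfinedHardSphereFlowOrbits
import Literature.Analysis.FluidPDE.HardSphereFlowGroup
import HarnessLib

/-!
# The group property of the event-by-event confined hard-sphere flow

Fourth layer of the proof of `ConfinedHardSphereFlow.nonempty_torus_balls` (existence of the
confined hard-sphere flow on the torus among fixed round scatterers; Cercignani–Illner–Pulvirenti
1994 §4.2 p. 65: "The family `{T^t; t ∈ ℝ}` is a group", reversibility (2.3)): for the
construction `ConfinedAlexander.flow` with good set `Γ₀ = ConfinedAlexander.good`, *`Γ₀` is
invariant and `T^t` is a group on it*, in every geometry regular at `ε` and `ρ` on a Hausdorff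
position space, among round scatterers `Wall.balls`. Line-by-line analogue of
`Literature.Analysis.FluidPDE.HardSphereFlowGroup` (wall-free case).

The proof goes through the **uniqueness / restart principle**: a confined hard-sphere trajectory
is reproduced by the event-by-event algorithm started at any of its values
(`IsConfinedHardSphereTrajectory.fwdFlow_apply_zero`, `fwdFlowLeft_apply_zero`,
`fwdGood_apply_zero`), obtained by following the algorithm one event at a time along the
trajectory (`next_event`); backward in time the same is applied to the time reversal
(`IsConfinedHardSphereTrajectory.timeReverse`), with one zero-time step prepended when the base
point is an event time. Since orbits of good points are confined trajectories
(`isConfinedHardSphereTrajectory_flow`), invariance of `Γ₀` (`mapsTo_flow_good`) and the group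
law (`flow_add_of_mem_good`) follow by reading both sides off the shifted orbit `s ↦ T^{s+t} z`.

## References

* C. Cercignani, R. Illner, M. Pulvirenti, *The Mathematical Theory of Dilute Gases*, Springer
  (1994), §4.2 p. 65 (the group `T^t` on `Γ₀`), eq. (2.3).
* R. K. Alexander, *The infinite hard sphere system*, PhD thesis, UC Berkeley (1975).
-/

open Set Filter Function
open scoped ENNReal Topology

namespace Literature.Analysis.FluidPDE

noncomputable section

section Kinetic

variable {d : Type*} [Fintype d] {X : Type*} {N : ℕ} {ι : Type*}

/-! ## A confined trajectory is reproduced by the event-by-event algorithm -/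

namespace IsConfinedHardSphereTrajectory

variable [TopologicalSpace X] {G : Geometry d X} {ε : ℝ} {ctr : ι → X} {ρ : ℝ} {hρ : 0 < ρ}
  {γ : ℝ → Config N d X}

section AnyWalls

variable {W : ι → Wall d X}

/-- **The next event after `s`**: either the trajectory is event-free after `s`, or there is a
first event time `T > s`. [folklore] -/
theorem exists_next_event (h : IsConfinedHardSphereTrajectory G W ε N γ) (s : ℝ) :
    (∀ σ, s < σ → σ ∉ eventTimes G W ε γ) ∨
    ∃ T, s < T ∧ T ∈ eventTimes G W ε γ ∧ ∀ σ ∈ Ioo s T, σ ∉ eventTimes G W ε γ := by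
  classical
  by_cases hex : ∃ σ, s < σ ∧ σ ∈ eventTimes G W ε γ
  · right
    obtain ⟨σ, hsσ, hσ⟩ := hex
    set F : Finset ℝ := ((h.locFinite s σ).toFinset).filter fun x => s < x with hF
    have hσF : σ ∈ F := Finset.mem_filter.2 ⟨(Set.Finite.mem_toFinset _).2 ⟨hσ, hsσ.le, le_rfl⟩, hsσ⟩
    have hne : F.Nonempty := ⟨σ, hσF⟩
    have hmin := Finset.mem_filter.1 (F.min'_mem hne)
    refine ⟨F.min' hne, hmin.2, ((Set.Finite.mem_toFinset _).1 hmin.1).1, fun τ hτ hcol => ?_⟩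
    have hτF : τ ∈ F := Finset.mem_filter.2
      ⟨(Set.Finite.mem_toFinset _).2 ⟨hcol, hτ.1.le, hτ.2.le.trans (F.min'_le σ hσF)⟩, hτ.1⟩
    exact (not_lt.2 (F.min'_le τ hτF)) hτ.2
  · exact Or.inl fun σ hσ hcol => hex ⟨σ, hσ, hcol⟩

/-- On an event-free window `(s, s + u]` the trajectory is the free flight of `γ s`. [folklore] -/
theorem apply_add_eq_freeFlight (h : IsConfinedHardSphereTrajectory G W ε N γ) {s u : ℝ} (hu : 0 ≤ u)
    (hfree : ∀ σ ∈ Ioc s (s + u), σ ∉ eventTimes G W ε γ) : γ (s + u) = freeFlight G u (γ s) := by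
  have hf := h.free s (s + u) (by linarith) hfree
  rwa [add_sub_cancel_left] at hf

/-- If the trajectory is event-free after `s`, the exit time of `γ s` is infinite. [folklore] -/
theorem exitTime_apply_eq_top (h : IsConfinedHardSphereTrajectory G W ε N γ) {s : ℝ}
    (hfree : ∀ σ, s < σ → σ ∉ eventTimes G W ε γ) : ConfinedAlexander.exitTime G W ε (γ s) = ∞ := by
  refine ConfinedAlexander.exitTime_eq_top_iff.2 fun u hu => ?_
  rw [← h.apply_add_eq_freeFlight hu fun σ hσ => hfree σ hσ.1]
  exact h.mem _

/-- A value with a sphere on a wall is at a wall-collision time. [folklore] -/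
theorem mem_eventTimes_of_mem_contact (h : IsConfinedHardSphereTrajectory G W ε N γ) {t : ℝ}
    {i : Fin N} {k : ι} (hc : (γ t i).1 ∈ (W k).contact) : t ∈ eventTimes G W ε γ :=
  Or.inr ⟨i, k, h.mem t, hc⟩

/-- At a pair-collision time `T` of a confined trajectory in a regular geometry, any
configuration with the positions of `γ T` in which the contact pair is incoming is a simple
pair-event configuration. [folklore] -/
theorem exists_isSimplePairEventWith (hG : G.IsHardSphereRegular ε)
    (h : IsConfinedHardSphereTrajectory G W ε N γ) {T : ℝ} {i j : Fin N} (hij : i ≠ j)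
    (hcT : γ T ∈ contactSet G N ε i j) {w : Config N d X} (hw : ∀ k, (w k).1 = (γ T k).1)
    (hin : IsIncoming G w i j) : ∃ p, ConfinedAlexander.IsSimplePairEventWith G W ε w p := by
  obtain ⟨huniq, hnow, -⟩ := h.binary T i j hij hcT
  have hnow' : ∀ (i' : Fin N) (k : ι), (w i').1 ∉ (W k).contact := fun i' k => by rw [hw]; exact hnow i' k
  rcases lt_or_gt_of_ne hij with hlt | hlt
  · refine ⟨(i, j), ⟨hlt, hin, fun i' j' hij' => ?_⟩, hnow'⟩
    rw [mem_contactSet_congr_fst hw]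
    refine ⟨huniq i' j' hij', fun he => ?_⟩
    rcases Alexander.finsetPair_eq_iff.1 he with ⟨rfl, rfl⟩ | ⟨rfl, rfl⟩
    · exact hcT
    · exact hG.mem_contactSet_comm.1 hcT
  · refine ⟨(j, i), ⟨hlt, (hG.isIncoming_comm ?_).2 hin, fun i' j' hij' => ?_⟩, hnow'⟩
    · exact ((mem_contactSet_congr_fst hw).2 hcT).2.le
    · rw [mem_contactSet_congr_fst hw]
      refine ⟨fun hc' => by rw [huniq i' j' hij' hc', Finset.pair_comm], fun he => ?_⟩
      rcases Alexander.finsetPair_eq_iff.1 he with ⟨rfl, rfl⟩ | ⟨rfl, rfl⟩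
      · exact hG.mem_contactSet_comm.1 hcT
      · exact hcT

/-- At a wall-collision time `T` of a confined trajectory, any configuration with the positions
of `γ T` in which the touching sphere is wall-incoming is a simple wall-event configuration. [folklore] -/
theorem isSimpleWallEventWith_of (h : IsConfinedHardSphereTrajectory G W ε N γ) {T : ℝ} {i : Fin N}
    {k : ι} (hcT : (γ T i).1 ∈ (W k).contact) {w : Config N d X} (hw : ∀ k, (w k).1 = (γ T k).1)
    (hin : IsWallIncoming (W k) w i) : ConfinedAlexander.IsSimpleWallEventWith G W ε w (i, k) := by
  obtain ⟨huniq, hnop, -⟩ := h.wall T i k hcT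
  refine ⟨by rw [hw]; exact hcT, hin, fun i' k' hc' => huniq i' k' (by rw [← hw]; exact hc'), fun i' j' hij' hc' => ?_⟩
  exact hnop i' j' hij' ((mem_contactSet_congr_fst hw).1 hc')

end AnyWalls

variable [T2Space X] [Finite ι]

/-- The exit time of a value of a confined trajectory is positive (its contacts are outgoing;
round scatterers, regular geometry). [folklore] -/
theorem exitTime_apply_pos (hG : G.IsHardSphereRegular ε) (hGρ : G.IsHardSphereRegular ρ)
    (h : IsConfinedHardSphereTrajectory G (Wall.balls G ctr ρ hρ) ε N γ) (s : ℝ) :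
    0 < ConfinedAlexander.exitTime G (Wall.balls G ctr ρ hρ) ε (γ s) :=
  ConfinedAlexander.exitTime_pos hG hGρ (h.mem s)
    (fun _ _ hij hc hin => lt_asymm hin (h.isOutgoing_of_mem_contactSet hij hc))
    (fun _ _ hc hin => lt_asymm hin (h.isWallOutgoing_of_mem_contact hc))

omit [Finite ι] in
/-- **One step of the algorithm along a trajectory**: if `(s, T)` is event-free and `T` is an
event time, then the exit time of `γ s` is `T - s`, the exit configuration is the left limit
`γ(T⁻)`, it is a simple event configuration, and the event step maps `γ s` to `γ T`. [folklore] -/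
theorem next_event (hG : G.IsHardSphereRegular ε) (hGρ : G.IsHardSphereRegular ρ)
    (h : IsConfinedHardSphereTrajectory G (Wall.balls G ctr ρ hρ) ε N γ) {s T : ℝ} (hsT : s < T)
    (hT : T ∈ eventTimes G (Wall.balls G ctr ρ hρ) ε γ)
    (hfree : ∀ σ ∈ Ioo s T, σ ∉ eventTimes G (Wall.balls G ctr ρ hρ) ε γ) :
    ConfinedAlexander.exitTime G (Wall.balls G ctr ρ hρ) ε (γ s) = ENNReal.ofReal (T - s) ∧
    leftLim γ T = freeFlight G (T - s) (γ s) ∧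
    ConfinedAlexander.IsSimpleEvent G (Wall.balls G ctr ρ hρ) ε (freeFlight G (T - s) (γ s)) ∧
    ConfinedAlexander.eventStep G (Wall.balls G ctr ρ hρ) ε (γ s) = γ T := by
  set W := Wall.balls G ctr ρ hρ
  have hG' := hG.continuous_translate_left
  have hll : leftLim γ T = freeFlight G (T - s) (γ s) := h.leftLim_eq_freeFlight hG' hsT hfree
  have hwfst : ∀ k, (freeFlight G (T - s) (γ s) k).1 = (γ T k).1 := fun k => by
    rw [← hll]
    exact h.leftLim_apply_fst hG' T k
  -- the exit time, from an immediate exit of the free flight started at the left limit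
  have key : (∀ᶠ t : ℝ in 𝓝[>] 0, freeFlight G t (freeFlight G (T - s) (γ s)) ∉ confinedDomain G W N ε) →
      ConfinedAlexander.exitTime G W ε (γ s) = ENNReal.ofReal (T - s) := by
    intro hev
    refine le_antisymm ?_ (ConfinedAlexander.le_exitTime_of_forall_mem fun u hu hult => ?_)
    · refine ConfinedAlexander.exitTime_le_of_frequently (sub_pos.2 hsT).le ?_
      have htr : Tendsto (fun t : ℝ => t - (T - s)) (𝓝[>] (T - s)) (𝓝[>] 0) := by
        have hc : ContinuousWithinAt (fun t : ℝ => t - (T - s)) (Ioi (T - s)) (T - s) :=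
          (continuous_sub_right (T - s)).continuousWithinAt
        have h0 : (fun t : ℝ => t - (T - s)) (T - s) = 0 := sub_self _
        rw [← h0]
        exact hc.tendsto_nhdsWithin fun t ht => by
          have ht' : T - s < t := ht
          show t - (T - s) ∈ Ioi ((T - s) - (T - s))
          rw [sub_self]
          exact sub_pos.2 ht'
      refine ((htr.eventually hev).mono fun t ht => ?_).frequently
      rwa [← freeFlight_add, sub_add_cancel] at ht
    · have hu' : u < T - s := (ENNReal.ofReal_lt_ofReal_iff (sub_pos.2 hsT)).1 hult
      rw [← h.apply_add_eq_freeFlight hu fun σ hσ => hfree σ ⟨hσ.1, by linarith [hσ.2]⟩]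
      exact h.mem _
  -- finishing, given the event
  have finish : ConfinedAlexander.exitTime G W ε (γ s) = ENNReal.ofReal (T - s) →
      ConfinedAlexander.IsSimpleEvent G W ε (freeFlight G (T - s) (γ s)) →
      ConfinedAlexander.eventJump G W ε (freeFlight G (T - s) (γ s)) = γ T →
      ConfinedAlexander.exitTime G W ε (γ s) = ENNReal.ofReal (T - s) ∧
        leftLim γ T = freeFlight G (T - s) (γ s) ∧
        ConfinedAlexander.IsSimpleEvent G W ε (freeFlight G (T - s) (γ s)) ∧
        ConfinedAlexander.eventStep G W ε (γ s) = γ T := by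
    intro hτ hsimple hjump
    refine ⟨hτ, hll, hsimple, ?_⟩
    have hτr : (ConfinedAlexander.exitTime G W ε (γ s)).toReal = T - s := by
      rw [hτ, ENNReal.toReal_ofReal (sub_pos.2 hsT).le]
    have hτne : ConfinedAlexander.exitTime G W ε (γ s) ≠ ∞ := by rw [hτ]; exact ENNReal.ofReal_ne_top
    rw [ConfinedAlexander.eventStep_of_ne_top hτne, hτr, hjump]
  rcases hT with ⟨i, j, hij, hcT⟩ | ⟨i, k, -, hcT⟩
  · have hcw : freeFlight G (T - s) (γ s) ∈ contactSet G N ε i j := (mem_contactSet_congr_fst hwfst).2 hcT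
    obtain ⟨hin, hval⟩ := h.eq_collidePair_leftLim hij hcT
    rw [hll] at hin hval
    obtain ⟨p, hp⟩ := h.exists_isSimplePairEventWith hG hij hcT hwfst hin
    refine finish (key ?_) hp.isSimplePairEvent.isSimpleEvent ?_
    · exact ConfinedAlexander.eventually_freeFlight_not_mem_confinedDomain_of_isIncoming hG hij hcw hin
    · rw [hp.eventJump_eq, hval]
      exact (hp.1.collidePair_eq hG (fun _ => rfl) hij hcw).symm
  · have hcw : (freeFlight G (T - s) (γ s) i).1 ∈ (W k).contact := by rw [hwfst]; exact hcT
    obtain ⟨hin, hval⟩ := h.eq_reflectWall_leftLim hcT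
    rw [hll] at hin hval
    have hq := h.isSimpleWallEventWith_of hcT hwfst hin
    refine finish (key ?_) hq.isSimpleWallEvent.isSimpleEvent ?_
    · exact ConfinedAlexander.eventually_freeFlight_not_mem_confinedDomain_of_isWallIncoming hGρ hcw hin
    · rw [hq.eventJump_eq, hval]

omit [Finite ι] in
/-- **Free flight before the exit time**: for `0 ≤ u < τ(γ s)`, `γ (s + u) = S_u (γ s)` and
`s + u` (if `u > 0`) is not an event time. [folklore] -/
theorem apply_add_eq_freeFlight_of_lt (hG : G.IsHardSphereRegular ε) (hGρ : G.IsHardSphereRegular ρ)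
    (h : IsConfinedHardSphereTrajectory G (Wall.balls G ctr ρ hρ) ε N γ) {s u : ℝ} (hu : 0 ≤ u)
    (hlt : ENNReal.ofReal u < ConfinedAlexander.exitTime G (Wall.balls G ctr ρ hρ) ε (γ s)) :
    γ (s + u) = freeFlight G u (γ s) ∧ (0 < u → s + u ∉ eventTimes G (Wall.balls G ctr ρ hρ) ε γ) := by
  rcases h.exists_next_event s with hfree | ⟨T, hsT, hT, hfree⟩
  · exact ⟨h.apply_add_eq_freeFlight hu fun σ hσ => hfree σ hσ.1, fun hu0 => hfree _ (by linarith)⟩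
  · have hτ := (h.next_event hG hGρ hsT hT hfree).1
    rw [hτ, ENNReal.ofReal_lt_ofReal_iff (sub_pos.2 hsT)] at hlt
    exact ⟨h.apply_add_eq_freeFlight hu fun σ hσ => hfree σ ⟨hσ.1, by linarith [hσ.2]⟩,
      fun hu0 => hfree _ ⟨by linarith, by linarith⟩⟩

omit [Finite ι] in
/-- **The next event from a finite exit time.** [folklore] -/
theorem exists_next_of_ne_top (hG : G.IsHardSphereRegular ε) (hGρ : G.IsHardSphereRegular ρ)
    (h : IsConfinedHardSphereTrajectory G (Wall.balls G ctr ρ hρ) ε N γ) {s : ℝ}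
    (hfin : ConfinedAlexander.exitTime G (Wall.balls G ctr ρ hρ) ε (γ s) ≠ ∞) :
    ∃ T, s < T ∧ ConfinedAlexander.exitTime G (Wall.balls G ctr ρ hρ) ε (γ s) = ENNReal.ofReal (T - s) ∧
      T ∈ eventTimes G (Wall.balls G ctr ρ hρ) ε γ ∧ (∀ σ ∈ Ioo s T, σ ∉ eventTimes G (Wall.balls G ctr ρ hρ) ε γ) ∧
      leftLim γ T = freeFlight G (T - s) (γ s) ∧
      ConfinedAlexander.IsSimpleEvent G (Wall.balls G ctr ρ hρ) ε (freeFlight G (T - s) (γ s)) ∧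
      ConfinedAlexander.eventStep G (Wall.balls G ctr ρ hρ) ε (γ s) = γ T := by
  rcases h.exists_next_event s with hfree | ⟨T, hsT, hT, hfree⟩
  · exact absurd (h.exitTime_apply_eq_top hfree) hfin
  · obtain ⟨hτ, hll, hsimple, hstep⟩ := h.next_event hG hGρ hsT hT hfree
    exact ⟨T, hsT, hτ, hT, hfree, hll, hsimple, hstep⟩

omit [Finite ι] in
/-- Every state of the algorithm started at `γ 0` is a value of the trajectory. [folklore] -/
theorem exists_stateAfter_eq_apply (hG : G.IsHardSphereRegular ε) (hGρ : G.IsHardSphereRegular ρ)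
    (h : IsConfinedHardSphereTrajectory G (Wall.balls G ctr ρ hρ) ε N γ) (k : ℕ) :
    ∃ t, ConfinedAlexander.stateAfter G (Wall.balls G ctr ρ hρ) ε (γ 0) k = γ t := by
  induction k with
  | zero => exact ⟨0, rfl⟩
  | succ k ih =>
    obtain ⟨t, ht⟩ := ih
    rw [ConfinedAlexander.stateAfter_succ, ht]
    by_cases hfin : ConfinedAlexander.exitTime G (Wall.balls G ctr ρ hρ) ε (γ t) = ∞
    · exact ⟨t, ConfinedAlexander.eventStep_of_eq_top hfin⟩
    · obtain ⟨T, -, -, -, -, -, -, hstep⟩ := h.exists_next_of_ne_top hG hGρ hfin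
      exact ⟨T, hstep⟩

omit [Finite ι] in
/-- **The algorithm reproduces the events**: while the instants are finite, the `k`-th state of
the algorithm started at `γ 0` is `γ (t_k)`, and `t_k` (`k ≥ 1`) is an event time. [folklore] -/
theorem stateAfter_eq_apply (hG : G.IsHardSphereRegular ε) (hGρ : G.IsHardSphereRegular ρ)
    (h : IsConfinedHardSphereTrajectory G (Wall.balls G ctr ρ hρ) ε N γ) {k : ℕ}
    (hfin : ConfinedAlexander.eventInstant G (Wall.balls G ctr ρ hρ) ε (γ 0) k ≠ ∞) :
    ConfinedAlexander.stateAfter G (Wall.balls G ctr ρ hρ) ε (γ 0) k =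
        γ (ConfinedAlexander.eventInstant G (Wall.balls G ctr ρ hρ) ε (γ 0) k).toReal ∧
      (0 < k → (ConfinedAlexander.eventInstant G (Wall.balls G ctr ρ hρ) ε (γ 0) k).toReal ∈
        eventTimes G (Wall.balls G ctr ρ hρ) ε γ) := by
  set W := Wall.balls G ctr ρ hρ
  induction k with
  | zero => simp
  | succ k ih =>
    rw [ConfinedAlexander.eventInstant_succ, ENNReal.add_ne_top] at hfin
    obtain ⟨hk, -⟩ := ih hfin.1
    have hfin2 : ConfinedAlexander.exitTime G W ε (γ (ConfinedAlexander.eventInstant G W ε (γ 0) k).toReal) ≠ ∞ := by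
      rw [← hk]
      exact hfin.2
    obtain ⟨T, hsT, hτ, hT, -, -, -, hstep⟩ := h.exists_next_of_ne_top hG hGρ hfin2
    have htk1 : (ConfinedAlexander.eventInstant G W ε (γ 0) (k + 1)).toReal = T := by
      rw [ConfinedAlexander.eventInstant_succ, ENNReal.toReal_add hfin.1 hfin.2, hk, hτ,
        ENNReal.toReal_ofReal (sub_pos.2 hsT).le]
      ring
    refine ⟨?_, fun _ => ?_⟩
    · rw [ConfinedAlexander.stateAfter_succ, hk, hstep, htk1]
    · rw [htk1]
      exact hT

/-- **A trajectory value is forward-good.** [folklore] -/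
theorem fwdGood_apply_zero (hG : G.IsHardSphereRegular ε) (hGρ : G.IsHardSphereRegular ρ)
    (h : IsConfinedHardSphereTrajectory G (Wall.balls G ctr ρ hρ) ε N γ) :
    ConfinedAlexander.FwdGood G (Wall.balls G ctr ρ hρ) ε (γ 0) := by
  set W := Wall.balls G ctr ρ hρ
  refine ⟨fun k hk => ?_, fun k t ht hlt => ?_, ?_⟩
  · obtain ⟨t, hkt⟩ := h.exists_stateAfter_eq_apply hG hGρ k
    rw [hkt] at hk ⊢
    obtain ⟨T, hsT, hτ, -, -, -, hsimple, -⟩ := h.exists_next_of_ne_top hG hGρ hk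
    rwa [hτ, ENNReal.toReal_ofReal (sub_pos.2 hsT).le]
  · obtain ⟨s, hks⟩ := h.exists_stateAfter_eq_apply hG hGρ k
    rw [hks] at hlt ⊢
    obtain ⟨heq, hnot⟩ := h.apply_add_eq_freeFlight_of_lt hG hGρ ht.le hlt
    rw [← heq]
    exact ⟨fun i j hij hc => hnot ht (Or.inl ⟨i, j, hij, hc⟩),
      fun i k' hc => hnot ht (h.mem_eventTimes_of_mem_contact hc)⟩
  · by_contra hsum
    have hfin : ∀ k, ConfinedAlexander.eventInstant G W ε (γ 0) k ≠ ∞ := fun k =>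
      ne_top_of_le_ne_top hsum (ENNReal.sum_le_tsum (Finset.range k))
    have hpos : ∀ k, 0 < ConfinedAlexander.exitTime G W ε (ConfinedAlexander.stateAfter G W ε (γ 0) k) := by
      intro k
      obtain ⟨t, hkt⟩ := h.exists_stateAfter_eq_apply hG hGρ k
      rw [hkt]
      exact h.exitTime_apply_pos hG hGρ t
    have hmono : StrictMono fun k => (ConfinedAlexander.eventInstant G W ε (γ 0) k).toReal := by
      refine strictMono_nat_of_lt_succ fun k => ?_
      rw [ENNReal.toReal_lt_toReal (hfin k) (hfin (k + 1)), ConfinedAlexander.eventInstant_succ]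
      exact ENNReal.lt_add_right (hfin k) (hpos k).ne'
    set S := (∑' k, ConfinedAlexander.exitTime G W ε (ConfinedAlexander.stateAfter G W ε (γ 0) k)).toReal
    have hmem : ∀ k, (ConfinedAlexander.eventInstant G W ε (γ 0) (k + 1)).toReal ∈
        eventTimes G W ε γ ∩ Icc 0 S := fun k =>
      ⟨(h.stateAfter_eq_apply hG hGρ (hfin (k + 1))).2 (Nat.succ_pos k), ENNReal.toReal_nonneg,
        ENNReal.toReal_mono hsum (ENNReal.sum_le_tsum _)⟩
    exact (h.locFinite 0 S).not_infinite (Set.infinite_of_injective_forall_mem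
      (fun a b hab => Nat.succ_injective (hmono.injective hab)) hmem)

/-- **The forward flow reproduces the trajectory**: `Φ_u (γ 0) = γ u` for `u ≥ 0`. [folklore] -/
theorem fwdFlow_apply_zero (hG : G.IsHardSphereRegular ε) (hGρ : G.IsHardSphereRegular ρ)
    (h : IsConfinedHardSphereTrajectory G (Wall.balls G ctr ρ hρ) ε N γ) {u : ℝ} (hu : 0 ≤ u) :
    ConfinedAlexander.fwdFlow G (Wall.balls G ctr ρ hρ) ε (γ 0) u = γ u := by
  set W := Wall.balls G ctr ρ hρ
  have hgood := h.fwdGood_apply_zero hG hGρ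
  obtain ⟨k, h1, h2⟩ := hgood.exists_segment u
  have hfin : ConfinedAlexander.eventInstant G W ε (γ 0) k ≠ ∞ := ne_top_of_le_ne_top ENNReal.ofReal_ne_top h1
  obtain ⟨hk, -⟩ := h.stateAfter_eq_apply hG hGρ hfin
  rw [ConfinedAlexander.fwdFlow_eq_of_segment h1 h2, hk]
  have hle : (ConfinedAlexander.eventInstant G W ε (γ 0) k).toReal ≤ u := ENNReal.toReal_le_of_le_ofReal hu h1
  have hlt : ENNReal.ofReal (u - (ConfinedAlexander.eventInstant G W ε (γ 0) k).toReal) <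
      ConfinedAlexander.exitTime G W ε (γ (ConfinedAlexander.eventInstant G W ε (γ 0) k).toReal) := by
    rw [← hk]
    rw [ConfinedAlexander.eventInstant_succ] at h2
    exact Alexander.ofReal_sub_toReal_lt hu h1 h2
  obtain ⟨heq, -⟩ := h.apply_add_eq_freeFlight_of_lt hG hGρ (sub_nonneg.2 hle) hlt
  rw [← heq, add_sub_cancel]

/-- **The left-continuous forward flow reproduces the left limits**: `Φ_{u⁻} (γ 0) = γ(u⁻)` for `u > 0`. [folklore] -/
theorem fwdFlowLeft_apply_zero (hG : G.IsHardSphereRegular ε) (hGρ : G.IsHardSphereRegular ρ)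
    (h : IsConfinedHardSphereTrajectory G (Wall.balls G ctr ρ hρ) ε N γ) {u : ℝ} (hu : 0 < u) :
    ConfinedAlexander.fwdFlowLeft G (Wall.balls G ctr ρ hρ) ε (γ 0) u = leftLim γ u := by
  set W := Wall.balls G ctr ρ hρ
  have hgood := h.fwdGood_apply_zero hG hGρ
  obtain ⟨k, h1, h2⟩ := hgood.exists_segment_left hu
  have hfin : ConfinedAlexander.eventInstant G W ε (γ 0) k ≠ ∞ := ne_top_of_lt h1
  obtain ⟨hk, -⟩ := h.stateAfter_eq_apply hG hGρ hfin
  rw [ConfinedAlexander.fwdFlowLeft_eq_of_segment (Or.inl h1) h2, hk]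
  set tk := (ConfinedAlexander.eventInstant G W ε (γ 0) k).toReal with htk
  have hlt : tk < u := ENNReal.toReal_lt_of_lt_ofReal h1
  refine (h.leftLim_eq_freeFlight hG.continuous_translate_left hlt fun σ hσ => ?_).symm
  have hσ0 : 0 ≤ σ := ENNReal.toReal_nonneg.trans hσ.1.le
  have h1σ : ConfinedAlexander.eventInstant G W ε (γ 0) k ≤ ENNReal.ofReal σ := by
    rw [← ENNReal.ofReal_toReal hfin]
    exact ENNReal.ofReal_le_ofReal hσ.1.le
  have hσlt : ENNReal.ofReal (σ - tk) < ConfinedAlexander.exitTime G W ε (γ tk) := by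
    rw [htk, ← hk]
    have h2' : ENNReal.ofReal σ < ConfinedAlexander.eventInstant G W ε (γ 0) (k + 1) :=
      lt_of_lt_of_le ((ENNReal.ofReal_lt_ofReal_iff hu).2 hσ.2) h2
    rw [ConfinedAlexander.eventInstant_succ] at h2'
    exact Alexander.ofReal_sub_toReal_lt hσ0 h1σ h2'
  obtain ⟨-, hnot⟩ := h.apply_add_eq_freeFlight_of_lt hG hGρ (sub_pos.2 hσ.1).le hσlt
  have hσ' := hnot (sub_pos.2 hσ.1)
  rwa [add_sub_cancel] at hσ'

end IsConfinedHardSphereTrajectory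

/-! ## An initial instant event: prepending a zero-time step -/

namespace ConfinedAlexander

variable {G : Geometry d X} {W : ι → Wall d X} {ε : ℝ} {y : Config N d X}

/-- `z_1 = T z`. [folklore] -/
theorem stateAfter_one (y : Config N d X) : stateAfter G W ε y 1 = eventStep G W ε y := stateAfter_succ y 0

/-- The states of the dynamics restarted after the first step. [folklore] -/
theorem stateAfter_succ_eq_stateAfter_eventStep (y : Config N d X) (k : ℕ) :
    stateAfter G W ε y (k + 1) = stateAfter G W ε (eventStep G W ε y) k := by
  rw [add_comm, ← stateAfter_stateAfter y 1 k, stateAfter_one]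

/-- **Forward-goodness propagates backward through one step.** [folklore] -/
theorem FwdGood.of_eventStep (hsimple : IsSimpleEvent G W ε (freeFlight G (exitTime G W ε y).toReal y))
    (hnc : ∀ t : ℝ, 0 < t → ENNReal.ofReal t < exitTime G W ε y →
      (∀ i j : Fin N, i ≠ j → freeFlight G t y ∉ contactSet G N ε i j) ∧
      ∀ (i : Fin N) (k' : ι), (freeFlight G t y i).1 ∉ (W k').contact)
    (hnext : FwdGood G W ε (eventStep G W ε y)) : FwdGood G W ε y := by
  refine ⟨fun k => ?_, fun k => ?_, ?_⟩
  · cases k with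
    | zero => exact fun _ => hsimple
    | succ k =>
      rw [stateAfter_succ_eq_stateAfter_eventStep]
      exact hnext.1 k
  · cases k with
    | zero => exact hnc
    | succ k =>
      rw [stateAfter_succ_eq_stateAfter_eventStep]
      exact hnext.2.1 k
  · rw [tsum_eq_zero_add' ENNReal.summable]
    simp only [stateAfter_succ_eq_stateAfter_eventStep, stateAfter_zero]
    rw [hnext.2.2, add_top]

/-- **A zero-time first step does not change the left-continuous forward flow** at positive times. [folklore] -/
theorem fwdFlowLeft_eq_fwdFlowLeft_eventStep (hτ : exitTime G W ε y = 0) (hnext : FwdGood G W ε (eventStep G W ε y))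
    {u : ℝ} (hu : 0 < u) : fwdFlowLeft G W ε y u = fwdFlowLeft G W ε (eventStep G W ε y) u := by
  have hinst : ∀ k, eventInstant G W ε y (k + 1) = eventInstant G W ε (eventStep G W ε y) k := by
    intro k
    induction k with
    | zero => rw [eventInstant_one, hτ, eventInstant_zero]
    | succ k ih =>
      rw [eventInstant_succ, ih, stateAfter_succ_eq_stateAfter_eventStep, ← eventInstant_succ]
  obtain ⟨k, h1, h2⟩ := hnext.exists_segment_left hu
  rw [fwdFlowLeft_eq_of_segment (Or.inl h1) h2,
    fwdFlowLeft_eq_of_segment (k := k + 1) (Or.inl (by rwa [hinst])) (by rwa [hinst]), hinst,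
    stateAfter_succ_eq_stateAfter_eventStep]

end ConfinedAlexander

/-! ## The flipped value of a trajectory: backward goodness and the backward flow -/

namespace IsConfinedHardSphereTrajectory

variable [TopologicalSpace X] [T2Space X] [Finite ι] {G : Geometry d X} {ε : ℝ} {ctr : ι → X} {ρ : ℝ}
  {hρ : 0 < ρ} {γ : ℝ → Config N d X}

omit [Finite ι] in
/-- **At an event time the flipped value jumps instantly back to the flipped left limit**: if
`0` is an event time of `γ` then `S (γ 0)` has zero exit time, is a simple event configuration,
and its event step is `S (γ(0⁻))`. [folklore] -/
theorem eventStep_flipVel_apply_zero (hG : G.IsHardSphereRegular ε) (hGρ : G.IsHardSphereRegular ρ)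
    (h : IsConfinedHardSphereTrajectory G (Wall.balls G ctr ρ hρ) ε N γ)
    (h0 : (0 : ℝ) ∈ eventTimes G (Wall.balls G ctr ρ hρ) ε γ) :
    ConfinedAlexander.exitTime G (Wall.balls G ctr ρ hρ) ε (flipVel (γ 0)) = 0 ∧
    ConfinedAlexander.IsSimpleEvent G (Wall.balls G ctr ρ hρ) ε (flipVel (γ 0)) ∧
    ConfinedAlexander.eventStep G (Wall.balls G ctr ρ hρ) ε (flipVel (γ 0)) = flipVel (leftLim γ 0) := by
  set W := Wall.balls G ctr ρ hρ
  have finish : ConfinedAlexander.exitTime G W ε (flipVel (γ 0)) = 0 →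
      ConfinedAlexander.IsSimpleEvent G W ε (flipVel (γ 0)) →
      ConfinedAlexander.eventJump G W ε (flipVel (γ 0)) = flipVel (leftLim γ 0) →
      ConfinedAlexander.exitTime G W ε (flipVel (γ 0)) = 0 ∧ ConfinedAlexander.IsSimpleEvent G W ε (flipVel (γ 0)) ∧
        ConfinedAlexander.eventStep G W ε (flipVel (γ 0)) = flipVel (leftLim γ 0) := by
    intro hτ0 hsimple hjump
    refine ⟨hτ0, hsimple, ?_⟩
    have hτne : ConfinedAlexander.exitTime G W ε (flipVel (γ 0)) ≠ ∞ := by rw [hτ0]; exact ENNReal.zero_ne_top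
    rw [ConfinedAlexander.eventStep_of_ne_top hτne, hτ0, ENNReal.toReal_zero, freeFlight_zero, hjump]
  rcases h0 with ⟨i, j, hij, hc⟩ | ⟨i, k, -, hc⟩
  · obtain ⟨hin, hval⟩ := h.eq_collidePair_leftLim hij hc
    have hc' : flipVel (γ 0) ∈ contactSet G N ε i j := (flipVel_mem_contactSet_iff _).2 hc
    have hin' : IsIncoming G (flipVel (γ 0)) i j := by
      rw [isIncoming_flipVel_iff, hval]
      exact (isOutgoing_collidePair_iff hij _).2 hin
    obtain ⟨p, hp⟩ := h.exists_isSimplePairEventWith hG hij hc (w := flipVel (γ 0)) (fun _ => rfl) hin'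
    refine finish (ConfinedAlexander.exitTime_eq_zero_of_isIncoming hG hij hc' hin') hp.isSimplePairEvent.isSimpleEvent ?_
    rw [hp.eventJump_eq, ← hp.1.collidePair_eq hG (fun _ => rfl) hij hc', collidePair_flipVel hij, hval,
      collidePair_collidePair hij]
  · obtain ⟨hin, hval⟩ := h.eq_reflectWall_leftLim hc
    have hc' : (flipVel (γ 0) i).1 ∈ (W k).contact := hc
    have hin' : IsWallIncoming (W k) (flipVel (γ 0)) i := by
      rw [isWallIncoming_flipVel_iff, hval]
      exact (isWallOutgoing_reflectWall_iff _ _ _).2 hin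
    have hq := h.isSimpleWallEventWith_of hc (w := flipVel (γ 0)) (fun _ => rfl) hin'
    refine finish (ConfinedAlexander.exitTime_eq_zero_of_isWallIncoming hGρ hc' hin') hq.isSimpleWallEvent.isSimpleEvent ?_
    rw [hq.eventJump_eq]
    change reflectWall (W k) i (flipVel (γ 0)) = flipVel (leftLim γ 0)
    rw [reflectWall_flipVel, hval, reflectWall_reflectWall]

/-- **The flipped value of a trajectory is forward-good** (reversibility). [folklore] -/
theorem fwdGood_flipVel_apply_zero (hG : G.IsHardSphereRegular ε) (hGρ : G.IsHardSphereRegular ρ)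
    (h : IsConfinedHardSphereTrajectory G (Wall.balls G ctr ρ hρ) ε N γ) :
    ConfinedAlexander.FwdGood G (Wall.balls G ctr ρ hρ) ε (flipVel (γ 0)) := by
  set W := Wall.balls G ctr ρ hρ
  have hR : IsConfinedHardSphereTrajectory G W ε N (FluidPDE.timeReverse γ) := h.timeReverse hG.continuous_translate_left
  have hgoodR := hR.fwdGood_apply_zero hG hGρ
  rw [timeReverse_apply, neg_zero] at hgoodR
  by_cases hcol : (0 : ℝ) ∈ eventTimes G W ε γ
  · obtain ⟨hτ0, hsimple, hstep⟩ := h.eventStep_flipVel_apply_zero hG hGρ hcol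
    refine ConfinedAlexander.FwdGood.of_eventStep ?_ ?_ ?_
    · rw [hτ0, ENNReal.toReal_zero, freeFlight_zero]
      exact hsimple
    · intro t _ hlt
      rw [hτ0] at hlt
      exact absurd hlt ENNReal.not_lt_zero
    · rw [hstep]
      exact hgoodR
  · rwa [h.leftLim_eq_of_not_mem hG.continuous_translate_left hcol] at hgoodR

/-- **The backward flow reproduces the trajectory**: `Φ_{u⁻} (S (γ 0)) = S (γ (-u))` for `u > 0`
(CIP 1994 (2.3)). [cite: CIP1994, §4.2 (2.3)] -/
theorem fwdFlowLeft_flipVel_apply_zero (hG : G.IsHardSphereRegular ε) (hGρ : G.IsHardSphereRegular ρ)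
    (h : IsConfinedHardSphereTrajectory G (Wall.balls G ctr ρ hρ) ε N γ) {u : ℝ} (hu : 0 < u) :
    ConfinedAlexander.fwdFlowLeft G (Wall.balls G ctr ρ hρ) ε (flipVel (γ 0)) u = flipVel (γ (-u)) := by
  set W := Wall.balls G ctr ρ hρ
  have hG' := hG.continuous_translate_left
  have hR : IsConfinedHardSphereTrajectory G W ε N (FluidPDE.timeReverse γ) := h.timeReverse hG'
  have hL := hR.fwdFlowLeft_apply_zero hG hGρ hu
  rw [h.leftLim_timeReverse hG', timeReverse_apply, neg_zero] at hL
  by_cases hcol : (0 : ℝ) ∈ eventTimes G W ε γ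
  · obtain ⟨hτ0, -, hstep⟩ := h.eventStep_flipVel_apply_zero hG hGρ hcol
    have hgoodR := hR.fwdGood_apply_zero hG hGρ
    rw [timeReverse_apply, neg_zero, ← hstep] at hgoodR
    rw [ConfinedAlexander.fwdFlowLeft_eq_fwdFlowLeft_eventStep hτ0 hgoodR hu, hstep, hL]
  · rwa [h.leftLim_eq_of_not_mem hG' hcol] at hL

end IsConfinedHardSphereTrajectory

/-! ## The group property on the good set -/

namespace ConfinedAlexander

variable [TopologicalSpace X] [T2Space X] [Finite ι] {G : Geometry d X} {ε : ℝ} {ctr : ι → X} {ρ : ℝ}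
  {hρ : 0 < ρ}

/-- **The good set is invariant**: `T^t` maps `Γ₀` to itself (round scatterers, geometry regular
at `ε` and `ρ`, Hausdorff position space). [cite: CIP1994, §4.2 p. 65] -/
theorem mapsTo_flow_good (hG : G.IsHardSphereRegular ε) (hGρ : G.IsHardSphereRegular ρ) (t : ℝ) :
    MapsTo (flow (N := N) G (Wall.balls G ctr ρ hρ) ε t) (good G (Wall.balls G ctr ρ hρ) ε)
      (good G (Wall.balls G ctr ρ hρ) ε) := by
  intro z hz
  have hΓt := (isConfinedHardSphereTrajectory_flow hG hGρ hz).comp_add_right t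
  have hmem := hΓt.mem 0
  have hgood := hΓt.fwdGood_apply_zero hG hGρ
  have hgood' := hΓt.fwdGood_flipVel_apply_zero hG hGρ
  simp only [zero_add] at hmem hgood hgood'
  refine ⟨hmem, fun i j hij hc => ?_, fun i k hc => ?_, hgood, hgood'⟩
  · have hc0 : (fun s => flow G (Wall.balls G ctr ρ hρ) ε (s + t) z) 0 ∈ contactSet G N ε i j := by simpa using hc
    obtain ⟨huniq, hnow, zl, -, hin, hval⟩ := hΓt.binary 0 i j hij hc0
    simp only [zero_add] at huniq hnow hval
    refine ⟨?_, huniq, hnow⟩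
    rw [hval]
    exact (isOutgoing_collidePair_iff hij zl).2 hin
  · have hc0 : ((fun s => flow G (Wall.balls G ctr ρ hρ) ε (s + t) z) 0 i).1 ∈ (Wall.balls G ctr ρ hρ k).contact := by
      simpa using hc
    obtain ⟨huniq, hnop, zl, -, hin, hval⟩ := hΓt.wall 0 i k hc0
    simp only [zero_add] at huniq hnop hval
    refine ⟨?_, huniq, hnop⟩
    rw [hval]
    exact (isWallOutgoing_reflectWall_iff _ i zl).2 hin

/-- **The group law on the good set**: `T^{s+t} z = T^s (T^t z)` for `z ∈ Γ₀`. [cite: CIP1994, §4.2 p. 65] -/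
theorem flow_add_of_mem_good (hG : G.IsHardSphereRegular ε) (hGρ : G.IsHardSphereRegular ρ) (s t : ℝ)
    {z : Config N d X} (hz : z ∈ good G (Wall.balls G ctr ρ hρ) ε) :
    flow G (Wall.balls G ctr ρ hρ) ε (s + t) z =
      flow G (Wall.balls G ctr ρ hρ) ε s (flow G (Wall.balls G ctr ρ hρ) ε t z) := by
  have hΓt := (isConfinedHardSphereTrajectory_flow hG hGρ hz).comp_add_right t
  rcases le_or_gt 0 s with hs | hs
  · have h1 := hΓt.fwdFlow_apply_zero hG hGρ hs
    simp only [zero_add] at h1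
    rw [flow_of_nonneg hs, h1]
  · have h2 := hΓt.fwdFlowLeft_flipVel_apply_zero hG hGρ (neg_pos.2 hs)
    simp only [zero_add, neg_neg] at h2
    rw [flow_of_neg hs, h2, flipVel_flipVel]

/-- **The constructed confined flow is a group on its invariant good set on the flat torus among
round scatterers**, `ε < 1/2`, `0 < ρ < 1/2`: `T^t Γ₀ ⊆ Γ₀`, `T⁰ = id` and `T^{s+t} = T^s ∘ T^t`
on `Γ₀` (CIP 1994 §4.2 p. 65). [cite: CIP1994, §4.2 p. 65] -/
theorem flow_group_torus {ε ρ : ℝ} (hε' : ε < 2⁻¹) (hρ : 0 < ρ) (hρ' : ρ < 2⁻¹)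
    (ctr : ι → UnitAddTorus d) (N : ℕ) :
    (∀ t : ℝ, MapsTo (flow (N := N) (Torus.geometry d) (Wall.balls (Torus.geometry d) ctr ρ hρ) ε t)
      (good (Torus.geometry d) (Wall.balls (Torus.geometry d) ctr ρ hρ) ε)
      (good (Torus.geometry d) (Wall.balls (Torus.geometry d) ctr ρ hρ) ε)) ∧
    (∀ z ∈ good (N := N) (Torus.geometry d) (Wall.balls (Torus.geometry d) ctr ρ hρ) ε,
      flow (Torus.geometry d) (Wall.balls (Torus.geometry d) ctr ρ hρ) ε 0 z = z) ∧
    (∀ s t : ℝ, ∀ z ∈ good (N := N) (Torus.geometry d) (Wall.balls (Torus.geometry d) ctr ρ hρ) ε,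
      flow (Torus.geometry d) (Wall.balls (Torus.geometry d) ctr ρ hρ) ε (s + t) z =
        flow (Torus.geometry d) (Wall.balls (Torus.geometry d) ctr ρ hρ) ε s
          (flow (Torus.geometry d) (Wall.balls (Torus.geometry d) ctr ρ hρ) ε t z)) := by
  have hG := Torus.isHardSphereRegular_geometry (d := d) hε'
  have hGρ := Torus.isHardSphereRegular_geometry (d := d) hρ'
  exact ⟨fun t => mapsTo_flow_good hG hGρ t, fun z hz => flow_zero_of_mem_good hG hGρ hz,
    fun s t z hz => flow_add_of_mem_good hG hGρ s t hz⟩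

end ConfinedAlexander

end Kinetic

end

end Literature.Analysis.FluidPDE
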